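import Summits.Ventures.CertifiedManyBodySolver.Certificates.HubbardSquare_transportClosure_Kit
import HarnessLib

/-!
# Ventures/CertifiedManyBodySolver — Certificates/HubbardSquare_transportClosure_KitFS.lean
# (hubbard-fast-reuse-1 g6, cell hubbard-fast, D-0154 (A) CERTIFICATE REUSE: the TRANSPORT-CLOSURE kit, part FS = the FREE-SEA (`U = 0`)
# ANCHOR OVER A HOPPING INTERVAL; companion of `…_Kit` (slices), `…_KitLaws` (`U`-chord / `U`-secant laws), `…_KitZ` (reuse-3's point anchor))

One GLUE adapter. The kernel tangent Fermi-sea rows `S + μ·n ≤ e(t, s₀, U, n)` (every `U ≥ 0`, every real `0 ≤ n < 2`;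
`Literature/…/HubbardFermiSeaTangentRows*`) are exact-to-rounding affine minorants of the FREE gas at the hopping column `s₀`.
Two such rows at columns `sa < sb`, read at `U = 0` and interpolated along `t'` by the joint concavity of `(s, U) ↦ e₀`
(`energyDensityTT'_ge_convexComb`, [Israel 1979, Thm. I.3.4]), give a floor AT `U₀ = 0` that is BILINEAR in `(s, n)` on any
`[s₁, s₂] ⊆ [sa, sb]`, `[n₁, n₂] ⊂ [0, 2)`:
`((sb − s)(Sa + μa n) + (s − sa)(Sb + μb n))/(sb − sa) ≤ e(t, s, 0, n)`.
`tc_sliceU0_floor_of_freeRowChord` turns a LITERAL bilinear form `α₀ + α₁ s + α₂ n + α₃ s n` lying below that chord at the four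
corners (four checks; the difference is bilinear, `bilinear_nonneg_on_rect`) into exactly the `hA` input (the `U`-slice floor at `U₀`) of
`KitLaws.tc_mlFloor_Uchord` (⇒ FREE-ANCHORED `U`-CHORD FLOORS on cells of positive `t'`-width, the interval form of reuse-3's `KitZ` point anchor)
and of `KitLaws.tc_mlCap_Usecx` with `U₀ := 0` (⇒ FREE-ANCHORED `U`-SECANT CAPS: a cap word read at `U₁` extended to `U ≥ U₁` with the slope bound
`(cap(U₁) − free floor)/U₁`, which never exceeds the Hartree slope `(n/2)²` when the cap at `U₁` is below Hartree–Fock).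
HONEST FRAMING: a bookkeeping adapter around tree lemmas; it certifies nothing by itself; every consumer word inherits exactly the two rows it
cites (kernel theorems, no hypotheses) plus its other partners' hypotheses; no number of record; not a phase word; no summit statement is proved
here; not a superconductivity verdict.
-/

namespace Summit.Ventures.CertifiedManyBodySolver.Certificates

open Literature.MathematicalPhysics.QuantumLattice
open Literature.MathematicalPhysics.QuantumLattice.ThermodynamicLimit
open Set

/-- **Two free rows ⇒ `U`-slice floor at `U₀ = 0` over a hopping interval.** Tangent Fermi-sea rows `Sa + μa·n ≤ e(t, sa, U, n)` and
`Sb + μb·n ≤ e(t, sb, U, n)` (all `U ≥ 0`, `0 ≤ n < 2`) with `sa < sb` give, for `sa ≤ s₁ ≤ s ≤ s₂ ≤ sb` and `0 ≤ n₁ ≤ n ≤ n₂ < 2`, the chord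
floor `((sb − s)(Sa + μa n) + (s − sa)(Sb + μb n))/(sb − sa) ≤ e(t, s, 0, n)` (joint concavity in `(t', U)` read along `t'` at `U = 0`);
a literal bilinear form below it at the four corners of `[s₁, s₂] × [n₁, n₂]` is a floor `≤ e(t, s, 0, n)` there — the `hA` input of
`tc_mlFloor_Uchord` / `tc_mlCap_Usecx` with `U₀ := 0`. [cite: Israel1979, Thm. I.3.4] [cite: LiebLoss1993, §8, Theorem 8.2] -/
theorem tc_sliceU0_floor_of_freeRowChord (t : ℝ) {sa sb Sa μa Sb μb s₁ s₂ n₁ n₂ α₀ α₁ α₂ α₃ : ℝ}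
    (ra : ∀ U : ℝ, 0 ≤ U → ∀ n : ℝ, 0 ≤ n → n < 2 → Sa + μa * n ≤ energyDensityTT' t sa U n)
    (rb : ∀ U : ℝ, 0 ≤ U → ∀ n : ℝ, 0 ≤ n → n < 2 → Sb + μb * n ≤ energyDensityTT' t sb U n)
    (hs : sa < sb) (h₁ : sa ≤ s₁) (h₂ : s₂ ≤ sb) (hn₁ : 0 ≤ n₁) (hn₂ : n₂ < 2)
    (w₁₁ : (α₀ + α₁ * s₁ + α₂ * n₁ + α₃ * s₁ * n₁) * (sb - sa) ≤ (sb - s₁) * (Sa + μa * n₁) + (s₁ - sa) * (Sb + μb * n₁))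
    (w₁₂ : (α₀ + α₁ * s₁ + α₂ * n₂ + α₃ * s₁ * n₂) * (sb - sa) ≤ (sb - s₁) * (Sa + μa * n₂) + (s₁ - sa) * (Sb + μb * n₂))
    (w₂₁ : (α₀ + α₁ * s₂ + α₂ * n₁ + α₃ * s₂ * n₁) * (sb - sa) ≤ (sb - s₂) * (Sa + μa * n₁) + (s₂ - sa) * (Sb + μb * n₁))
    (w₂₂ : (α₀ + α₁ * s₂ + α₂ * n₂ + α₃ * s₂ * n₂) * (sb - sa) ≤ (sb - s₂) * (Sa + μa * n₂) + (s₂ - sa) * (Sb + μb * n₂)) :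
    ∀ s n : ℝ, s₁ ≤ s → s ≤ s₂ → n₁ ≤ n → n ≤ n₂ →
      α₀ + α₁ * s + α₂ * n + α₃ * s * n ≤ energyDensityTT' t s 0 n := by
  intro s n k3 k4 k5 k6
  have hn0 : 0 ≤ n := hn₁.trans k5
  have hn2 : n < 2 := lt_of_le_of_lt k6 hn₂
  have hA' : Sa + μa * n ≤ energyDensityTT' t sa 0 n := ra 0 le_rfl n hn0 hn2
  have hB' : Sb + μb * n ≤ energyDensityTT' t sb 0 n := rb 0 le_rfl n hn0 hn2
  have hd : 0 < sb - sa := sub_pos.2 hs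
  have hd0 : sb - sa ≠ 0 := hd.ne'
  have hsa : sa ≤ s := h₁.trans k3
  have hsb : s ≤ sb := k4.trans h₂
  set a : ℝ := (sb - s) / (sb - sa) with ha_def
  set b : ℝ := (s - sa) / (sb - sa) with hb_def
  have ha0 : 0 ≤ a := div_nonneg (by linarith) hd.le
  have hb0 : 0 ≤ b := div_nonneg (by linarith) hd.le
  have hda : (sb - sa) * a = sb - s := by rw [ha_def]; field_simp
  have hdb : (sb - sa) * b = s - sa := by rw [hb_def]; field_simp
  have hab : a + b = 1 := by
    have h1 : (sb - sa) * (a + b) = (sb - sa) * 1 := by rw [mul_add, hda, hdb]; ring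
    exact mul_left_cancel₀ hd0 h1
  have hc := energyDensityTT'_ge_convexComb t hn0 hn2 (le_refl (0:ℝ)) (le_refl (0:ℝ)) ha0 hb0 hab hA' hB'
  have es : a * sa + b * sb = s := by
    have h1 : (sb - sa) * (a * sa + b * sb) = (sb - sa) * s := by
      rw [mul_add, ← mul_assoc, ← mul_assoc, hda, hdb]; ring
    exact mul_left_cancel₀ hd0 h1
  have eu : a * (0:ℝ) + b * 0 = 0 := by ring
  rw [es, eu] at hc
  -- (sb - s)(Sa + μa n) + (s - sa)(Sb + μb n) ≤ (sb - sa) e(t, s, 0, n)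
  have h1 : (sb - s) * (Sa + μa * n) + (s - sa) * (Sb + μb * n) ≤ (sb - sa) * energyDensityTT' t s 0 n := by
    have h2 := mul_le_mul_of_nonneg_left hc hd.le
    rw [mul_add, ← mul_assoc, ← mul_assoc, hda, hdb] at h2
    exact h2
  -- the literal form lies below the chord on the rectangle (difference is bilinear: four corners)
  have hv : 0 ≤ (sb * Sa - sa * Sb - α₀ * (sb - sa)) + (Sb - Sa - α₁ * (sb - sa)) * s +
      (sb * μa - sa * μb - α₂ * (sb - sa)) * n + (μb - μa - α₃ * (sb - sa)) * s * n :=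
    bilinear_nonneg_on_rect k3 k4 k5 k6 (by linear_combination w₁₁) (by linear_combination w₁₂)
      (by linear_combination w₂₁) (by linear_combination w₂₂)
  have h3 : (sb - sa) * (α₀ + α₁ * s + α₂ * n + α₃ * s * n) ≤ (sb - sa) * energyDensityTT' t s 0 n := by
    linear_combination h1 + hv
  exact le_of_mul_le_mul_left h3 hd

end Summit.Ventures.CertifiedManyBodySolver.Certificates
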